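import Summits.BirchSwinnertonDyer.Rank1Residual.X2.RankOneSplitResidueExact
import Summits.BirchSwinnertonDyer.Rank1Residual.X2.IsogenyClassStability
import Summits.BirchSwinnertonDyer.Rank1Residual.X2.ClassClosureO9Certificate
import Literature.NumberTheory.EllipticCurves.Wuthrich2014.ShaBoundProofs
import HarnessLib

/-!
# Class X2c = residual class O9 at a SPLIT prime: the typed residue `O9.ExceptionalLeadingTermAt`
# TRANSPORTS along `ℚ`-isogenies modulo certificates, and is EXACT at class level on its exactness
# locus (cell `b2b-bsdres`, lane CLASS-CLOSURE, seat `cc-typer-6`, class O9 typer of record)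

HONEST FRAMING (run/shared/lean/b2b/bsd-rank1-residual/, verbatim in every file): the goal of the
cell is to DELETE the COMBINATION-SHAPED residual classes of the Birch–Swinnerton-Dyer formula for
ALL analytic-rank `≤ 1` elliptic curves over `ℚ` — "full BSD formula for every rank `≤ 1` curve in
class `C`" assembled STRICTLY from published theorems — so that the rank-`≤ 1` remainder becomes
exactly the CONSTRUCTION-SHAPED classes, which are TYPED (missing-input `Prop`s), NOT attempted.
This is not "finishing BSD". Research route; NO CLAIM BEYOND STATED CLASSES; census / instrument
output is EVIDENCE, never a Literature fact; nothing here changes a label; X2c stays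
CONSTRUCTION-SHAPED; `O9.ExceptionalLeadingTermAt` stays a `@[conjecture]` — nothing about it is
asserted here. THEOREMS ONLY: no definition, no new named fact; every class-level input is a
REGISTERED Literature fact BY NAME, every per-pair input a typed residue or a certificate binder.

## What (CLASS-CLOSURE-PLAN §3.7, experiment types (2)/(3); `class-closure/O9/LEAD-DEAL-o9p.md`
## items T-O9P-1 (a)/(a′)/(a″)/(b), written by the O9 typer of record so the arriving prover seats
## start at the EVIDENCE items and at T-O9P-2)

§1. **Transport of the per-pair certificate binders along a `ℚ`-isogeny** (`W ∼ W'`, globally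
minimal): the NON-split certificate bit "`[T¹]L_p ≠ 0` for THE Mazur–Tate–Teitelbaum function of
every newform of the curve" is literally isogeny-invariant (isogenous curves have the same newforms,
`IsNewformOf.of_isIsogenous`, and THE function depends on the newform only):
`O9.coeffOneCert_iff_of_isIsogenous`. By `ClassClosureO9Certificate` (`schneider_of_coeff_one_ne_zero_
of_thm1` / `coeff_one_ne_zero_of_schneider_of_thm1`) this bit IS the Schneider input on the non-split
half, so the non-split half of O9 is read per ISOGENY CLASS.

§2. **Transport of the typed SPLIT residue modulo certificates** (T-O9P-1 (a)/(a′)): on a split X2c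
pair the residue is EQUIVALENT to `BSD(E,p)` under an *exactness hypothesis* at the pair — either
(Mazur's MC at the pair ∧ the Schneider certificate for THE §4.2 height at every Tate datum)
(eisenstein-p2 `exceptionalLeadingTermAt_iff_bsdp_of_mazurMainConjectureAt_of_schneider_split`) or
λ-minimality `(μ_an, λ_an) = (0, 2)` (`…_iff_bsdp_of_lamMin_split`) — packaged ONCE as
`O9.exceptionalLeadingTermAt_iff_bsdp_of_exactnessHyp_split`; and `BSD(·,p)` passes along the isogeny
(Cassels, `Wuthrich2014.bsdp_of_isIsogenous`, fact `bsdRHS_eq_of_isIsogenous`; `Ш` finite by GZK;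
leading coefficient `≠ 0` by modularity), as do `CellC` (`cellC_iff_of_isIsogenous`) and the split bit
(`IsogenyQuotientLine.hasSplitMultiplicativeReductionAtPrime_iff_of_isIsogenous`). Hence
`O9.exceptionalLeadingTermAt_of_isIsogenous_of_exactnessHyp` /
`O9.exceptionalLeadingTermAt_iff_of_isIsogenous_of_exactnessHyp`: with an exactness hypothesis on
EACH side, `O9.ExceptionalLeadingTermAt W p ↔ O9.ExceptionalLeadingTermAt W' p`. What does NOT
transport for free: Mazur's MC at a RANK-ONE pair (the tree has the rank-`0` transport
`mazurMainConjectureAt_of_isIsogenous` only — at rank one `BSD(E,p)` does not give the main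
conjecture back), the Schneider certificate at a split pair, `μ_an` (the period ratio `ϖ` changes by
the isogeny degree; `λ` is invariant, `lambdaInvariant_eq_of_isIsogenous`) — so the binders stay on
both sides. VALUE for the instrument tables (EVIDENCE, `class-closure/O9/pairs.tsv` 5f2b1c3580c696a3):
the obsanat universe is ALREADY one row per (isogeny class, `p`) — 9 502 split cells = 9 502 classes
(9 054@3 · 413@5 · 35@7) — so the theorem's use is that the REPRESENTATIVE of a split cell may be
chosen freely in the class among the members carrying an exactness certificate (e.g. the λ-minimal
or Schneider-certified member of `O9/isogeny.tsv`), the residue statement moving with it.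

§3. **Rank-one residue EXACTNESS at class level** (T-O9P-1 (b); the X2c analogue of
`residueB_iff_targetB_of_facts`, honest form): on the exactness locus
{`CellC` ∧ split ∧ ((MC-at-pair ∧ Schneider-cert) ∨ λ-min)} the class-wide residue and the class-wide
`p`-part of BSD are EQUIVALENT granted the registered facts —
`O9.forall_exceptionalLeadingTermAt_iff_forall_bsdp_of_exactnessHyp`; in particular sub-cell X2c's
target of record `TargetC` IMPLIES the residue on that locus
(`O9.forall_exceptionalLeadingTermAt_of_targetC`), i.e. the residue list of
`target_of_facts_of_residues` (`hResCs`) is NECESSARY there, not merely sufficient. PRECISELY WHAT IS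
NOT EXACT (docstrings): the Schneider certificate is not recovered from `BSD(E,p)`; off the λ-minimal
cells the MC binder stays (route G needs a relative with KNOWN MC; nothing in print at a split
Eisenstein prime); `TargetC` itself carries no exactness hypothesis, so the equivalence is on the
locus, not on all of X2c.

Nothing is booked by this file; no mark moves; the irreducible residue for ideation is unchanged
(`O9.ExceptionalLeadingTermAt` on the 9 502 split cells, + Mazur's MC at split ∧ ¬GVPar ∧ ¬λ-min pairs).

References: [MilneADT2006] Thm. I.7.3 (Cassels' isogeny invariance); [Miller2011LMS] §1, Def. 1.1;
[SteinWuthrich2013] Thm. 6.1, §4.2; [MazurTateTeitelbaum1986Invent] §II.10; [Disegni2020] Conj. (BSD_p),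
Thm. 1, Thm. 4; [Wuthrich2014] Thm. 16; [Knapp1993] Thm. 11.67; [SilvermanAEC2009] §C.16;
HOME/class-closure/O9/{LEAD-DEAL-o9p.md 0d298759c31832d4, SUBPARTITION-typed.md, STATEMENT.md}.
-/

set_option autoImplicit false

noncomputable section

open scoped Classical MatrixGroups ModularForm

open PowerSeries CongruenceSubgroup WeierstrassCurve Literature.NumberTheory.EllipticCurves
  Literature.NumberTheory.EllipticCurves.ModularForms
  Literature.NumberTheory.EllipticCurves.Rank1Residual
  Literature.NumberTheory.EllipticCurves.Rank1Residual.Typed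
  Literature.NumberTheory.EllipticCurves.GreenbergVatsal2000
  Literature.NumberTheory.EllipticCurves.Wuthrich2014
  Literature.NumberTheory.EllipticCurves.SteinWuthrich2013
  Literature.NumberTheory.EllipticCurves.Disegni2020

namespace Summit.BirchSwinnertonDyer.Rank1Residual.X2

/-! ## §1. The non-split certificate bit is isogeny-invariant -/

section NonsplitCertificate

variable {W W' : WeierstrassCurve ℚ} [W.IsElliptic] [W'.IsElliptic] {p : ℕ} [Fact p.Prime]

/-- **The non-split certificate bit transports along a `ℚ`-isogeny** (any rank, any image): the
per-pair instrument input `hc1` of `bsdp_of_cellC_of_not_split_of_{gvPar|mazurMainConjectureAt}_of_thm1_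
of_coeff_one_ne_zero` — "`[T¹]L ≠ 0` for THE non-split Mazur–Tate–Teitelbaum function `L` of every
newform `f` of the curve" — holds for `W` iff it holds for an isogenous `W'`, because `W` and `W'`
have the same newforms (`IsNewformOf.of_isIsogenous`, equal `L`-functions, Knapp Thm. 11.67) and THE
function is attached to `(f, p)` alone. So on the non-split half of O9 the certificate table is read
per isogeny class. [cite: Knapp1993, Thm. 11.67 (PDF p. 281)] [cite: MazurTateTeitelbaum1986Invent, §I.13] -/
theorem O9.coeffOneCert_iff_of_isIsogenous (h : IsIsogenous W W') :
    (∀ {N : ℕ} [NeZero N] (f : CuspForm (Gamma0 N) 2), IsNewformOf W f →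
      ∀ (L : PowerSeries ℚ_[p]), IsMultPAdicLFunctionOf f p (-1) L → PowerSeries.coeff 1 L ≠ 0) ↔
    (∀ {N : ℕ} [NeZero N] (f : CuspForm (Gamma0 N) 2), IsNewformOf W' f →
      ∀ (L : PowerSeries ℚ_[p]), IsMultPAdicLFunctionOf f p (-1) L → PowerSeries.coeff 1 L ≠ 0) :=
  ⟨fun hc1 _ _ f hf L hL ↦ hc1 f (hf.of_isIsogenous h) L hL,
    fun hc1 _ _ f hf L hL ↦ hc1 f (hf.of_isIsogenous h.symm_of_charZero) L hL⟩

/-- **Hence, on the non-split half of O9, `BSD(·,p)` from the certificate bit of ANY curve of the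
isogeny class** (Mazur's MC at the target pair + `[T¹]L ≠ 0` read on an isogenous `W`): the data
`CellC`, non-split pass along the isogeny (`cellC_iff_of_isIsogenous`,
`IsogenyQuotientLine.hasSplitMultiplicativeReductionAtPrime_iff_of_isIsogenous`), the bit by
`O9.coeffOneCert_iff_of_isIsogenous`, and `ClassClosureO9Certificate`'s consumer closes. CONDITIONAL on
the per-pair MC binder at `W'`; nothing booked. [cite: Disegni2020, Thm. 1 (§1.2)]
[cite: SteinWuthrich2013, Thm. 6.1 (p. 20), §4.2] -/
theorem O9.bsdp_of_isIsogenous_of_not_split_of_mazurMainConjectureAt_of_coeff_one_ne_zero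
    [W.IsGloballyMinimal] [W'.IsGloballyMinimal]
    (hD : thm1_padicBSD_rankOne_multiplicative) (hJn : thm61_nonsplitMultiplicative)
    (hHn : exists_isMultCanonical) (hGZK : rank_eq_analyticRank_of_analyticRank_le_one)
    (hpar : nonempty_modularParametrizationData) (h : IsIsogenous W W')
    (hc : CellC W p) (hns : ¬ W.HasSplitMultiplicativeReductionAtPrime p)
    (hc1 : ∀ {N : ℕ} [NeZero N] (f : CuspForm (Gamma0 N) 2), IsNewformOf W f →
      ∀ (L : PowerSeries ℚ_[p]), IsMultPAdicLFunctionOf f p (-1) L → PowerSeries.coeff 1 L ≠ 0)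
    (hMC' : MazurMainConjectureAt W' p) : BSDp W' p :=
  bsdp_of_cellC_of_not_split_of_mazurMainConjectureAt_of_thm1_of_coeff_one_ne_zero W' p hD hJn hHn hGZK
    hpar ((cellC_iff_of_isIsogenous h).mp hc)
    (fun hs' ↦ hns ((IsogenyQuotientLine.hasSplitMultiplicativeReductionAtPrime_iff_of_isIsogenous h).mpr
      hs'))
    hMC' ((O9.coeffOneCert_iff_of_isIsogenous h).mp hc1)

end NonsplitCertificate

/-! ## §2. The split residue is exact under an exactness hypothesis, and transports along isogenies -/

section Split

variable (W : WeierstrassCurve ℚ) [W.IsElliptic] [W.IsGloballyMinimal] (p : ℕ) [Fact p.Prime]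

/-- **X2c, SPLIT `p`: the typed exceptional leading term IS `BSD(E,p)` under an EXACTNESS HYPOTHESIS
at the pair** — either (Mazur's MC at the pair ∧ the Schneider certificate for THE §4.2 height at
every Tate datum) or λ-minimality `(μ_an, λ_an) = (0, 2)` (typed binders `AnalyticMuLE W p 0`,
`AnalyticLambdaEq W p 2`; then MC and Schneider are theorems, eisenstein-p2 gens 4–5). One packaging
of eisenstein-p2's two `iff`s (`RankOneSplitResidueExact`), so that transport and class-level
statements below are written once. Class-level inputs: Wuthrich Thm. 16 (`hWu`), Stein–Wuthrich
Thm. 6.1 (`hJs`, `hJn`) with the §4.2 heights (`hHs`, `hHn`), Gross–Zagier I.(7.3) (`hGZ`), GZK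
(`hGZK`), modularity (`hpar`). [cite: SteinWuthrich2013, Thm. 6.1 (p. 20) and §4.2]
[cite: Wuthrich2014, Thm. 16 (p. 397)] [cite: MazurTateTeitelbaum1986Invent, §II.10] -/
theorem O9.exceptionalLeadingTermAt_iff_bsdp_of_exactnessHyp_split
    (hWu : thm16_charIdeal_dvd_multiplicative_of_reducible)
    (hJs : thm61_splitMultiplicative) (hJn : thm61_nonsplitMultiplicative)
    (hHs : exists_isSplitMultCanonical) (hHn : exists_isMultCanonical)
    (hGZ : GrossZagier1986_thm_I_7_3) (hGZK : rank_eq_analyticRank_of_analyticRank_le_one)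
    (hpar : nonempty_modularParametrizationData)
    (hc : CellC W p) (hsplit : W.HasSplitMultiplicativeReductionAtPrime p)
    (hEx : (MazurMainConjectureAt W p ∧
        ∀ (Dq : TateParameterData W p) (Dh : PAdicHeightData W p),
          IsSplitMultCanonical Dh Dq → SchneiderConjecture Dh) ∨
      (AnalyticMuLE W p 0 ∧ AnalyticLambdaEq W p 2)) :
    O9.ExceptionalLeadingTermAt W p ↔ BSDp W p := by
  rcases hEx with ⟨hMC, hSch⟩ | ⟨hμ0, hlam⟩
  · exact exceptionalLeadingTermAt_iff_bsdp_of_mazurMainConjectureAt_of_schneider_split W p hJs hHs hGZ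
      hGZK hpar hc hsplit hMC hSch
  · exact exceptionalLeadingTermAt_iff_bsdp_of_lamMin_split W p hWu hJs hJn hHs hHn hGZ hGZK hpar hc
      hsplit hμ0 hlam

variable {W p} {W' : WeierstrassCurve ℚ} [W'.IsElliptic] [W'.IsGloballyMinimal]

/-- **`BSD(·,p)` passes along a `ℚ`-isogeny on X2c** (Cassels; `Ш(W)` finite by GZK at analytic rank
`1`, leading coefficient `≠ 0` by modularity) — the light-import form of `X2.bsdp_of_isIsogenous_of_bsdp`
(`X2/RankOneHeegner.lean`) through `Wuthrich2014.bsdp_of_isIsogenous`.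
[cite: MilneADT2006, Thm. I.7.3 and Remark I.7.4] [cite: Miller2011LMS, §1] -/
theorem O9.bsdp_of_isIsogenous_of_cellC (hCassels : bsdRHS_eq_of_isIsogenous)
    (hGZK : rank_eq_analyticRank_of_analyticRank_le_one) (hmod : hasEntireLFunction_rat)
    (h : IsIsogenous W W') (hc : CellC W p) (hB : BSDp W p) : BSDp W' p := by
  obtain ⟨-, hfin⟩ := hGZK W hc.1.le
  exact Wuthrich2014.bsdp_of_isIsogenous hCassels h.symm_of_charZero hfin
    (WeierstrassCurve.leadingLCoeff_ne_zero_holds (hmod W)) hB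

/-- **T-O9P-1 (a)/(a′): the typed SPLIT residue transports along a `ℚ`-isogeny modulo certificates.**
For globally minimal `W ∼ W'` isogenous over `ℚ`, `(W,p)` in X2c and split, with an exactness
hypothesis ((MC-at-pair ∧ Schneider-cert) ∨ λ-min) at `W` AND at `W'`:
`O9.ExceptionalLeadingTermAt W p → O9.ExceptionalLeadingTermAt W' p`. Proof = exactness at `W` ∘
Cassels ∘ exactness at `W'`; `CellC` and the split bit pass along the isogeny by tree theorems. The
binders that do NOT drop: MC at a rank-one pair (no rank-one transport in the tree or in print at a
split Eisenstein prime), the Schneider certificate, `μ_an` (`λ` alone is invariant,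
`lambdaInvariant_eq_of_isIsogenous`). Nothing asserted about the residue; nothing booked.
[cite: MilneADT2006, Thm. I.7.3] [cite: SteinWuthrich2013, Thm. 6.1 (p. 20) and §4.2]
[cite: MazurTateTeitelbaum1986Invent, §II.10] [cite: SilvermanAEC2009, §C.16] -/
theorem O9.exceptionalLeadingTermAt_of_isIsogenous_of_exactnessHyp
    (hWu : thm16_charIdeal_dvd_multiplicative_of_reducible)
    (hJs : thm61_splitMultiplicative) (hJn : thm61_nonsplitMultiplicative)
    (hHs : exists_isSplitMultCanonical) (hHn : exists_isMultCanonical)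
    (hGZ : GrossZagier1986_thm_I_7_3) (hGZK : rank_eq_analyticRank_of_analyticRank_le_one)
    (hmod : hasEntireLFunction_rat) (hpar : nonempty_modularParametrizationData)
    (hCassels : bsdRHS_eq_of_isIsogenous)
    (h : IsIsogenous W W') (hc : CellC W p) (hsplit : W.HasSplitMultiplicativeReductionAtPrime p)
    (hEx : (MazurMainConjectureAt W p ∧
        ∀ (Dq : TateParameterData W p) (Dh : PAdicHeightData W p),
          IsSplitMultCanonical Dh Dq → SchneiderConjecture Dh) ∨
      (AnalyticMuLE W p 0 ∧ AnalyticLambdaEq W p 2))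
    (hEx' : (MazurMainConjectureAt W' p ∧
        ∀ (Dq : TateParameterData W' p) (Dh : PAdicHeightData W' p),
          IsSplitMultCanonical Dh Dq → SchneiderConjecture Dh) ∨
      (AnalyticMuLE W' p 0 ∧ AnalyticLambdaEq W' p 2))
    (hExc : O9.ExceptionalLeadingTermAt W p) : O9.ExceptionalLeadingTermAt W' p := by
  have hc' : CellC W' p := (cellC_iff_of_isIsogenous h).mp hc
  have hsplit' : W'.HasSplitMultiplicativeReductionAtPrime p :=
    IsogenyQuotientLine.hasSplitMultiplicativeReductionAtPrime_of_isIsogenous h hsplit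
  have hB : BSDp W p :=
    (O9.exceptionalLeadingTermAt_iff_bsdp_of_exactnessHyp_split W p hWu hJs hJn hHs hHn hGZ hGZK hpar hc
      hsplit hEx).mp hExc
  exact (O9.exceptionalLeadingTermAt_iff_bsdp_of_exactnessHyp_split W' p hWu hJs hJn hHs hHn hGZ hGZK
    hpar hc' hsplit' hEx').mpr (O9.bsdp_of_isIsogenous_of_cellC hCassels hGZK hmod h hc hB)

/-- **The `iff` form of the transport**: with an exactness hypothesis on both sides of a `ℚ`-isogeny
`W ∼ W'` (X2c, split), `O9.ExceptionalLeadingTermAt W p ↔ O9.ExceptionalLeadingTermAt W' p` — the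
per-pair EVIDENCE / certificate table for the split residue may take ANY certified member of the
isogeny class as the cell's representative. [cite: MilneADT2006, Thm. I.7.3]
[cite: SteinWuthrich2013, Thm. 6.1 (p. 20) and §4.2] [cite: MazurTateTeitelbaum1986Invent, §II.10] -/
theorem O9.exceptionalLeadingTermAt_iff_of_isIsogenous_of_exactnessHyp
    (hWu : thm16_charIdeal_dvd_multiplicative_of_reducible)
    (hJs : thm61_splitMultiplicative) (hJn : thm61_nonsplitMultiplicative)
    (hHs : exists_isSplitMultCanonical) (hHn : exists_isMultCanonical)
    (hGZ : GrossZagier1986_thm_I_7_3) (hGZK : rank_eq_analyticRank_of_analyticRank_le_one)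
    (hmod : hasEntireLFunction_rat) (hpar : nonempty_modularParametrizationData)
    (hCassels : bsdRHS_eq_of_isIsogenous)
    (h : IsIsogenous W W') (hc : CellC W p) (hsplit : W.HasSplitMultiplicativeReductionAtPrime p)
    (hEx : (MazurMainConjectureAt W p ∧
        ∀ (Dq : TateParameterData W p) (Dh : PAdicHeightData W p),
          IsSplitMultCanonical Dh Dq → SchneiderConjecture Dh) ∨
      (AnalyticMuLE W p 0 ∧ AnalyticLambdaEq W p 2))
    (hEx' : (MazurMainConjectureAt W' p ∧
        ∀ (Dq : TateParameterData W' p) (Dh : PAdicHeightData W' p),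
          IsSplitMultCanonical Dh Dq → SchneiderConjecture Dh) ∨
      (AnalyticMuLE W' p 0 ∧ AnalyticLambdaEq W' p 2)) :
    O9.ExceptionalLeadingTermAt W p ↔ O9.ExceptionalLeadingTermAt W' p :=
  ⟨O9.exceptionalLeadingTermAt_of_isIsogenous_of_exactnessHyp hWu hJs hJn hHs hHn hGZ hGZK hmod hpar
      hCassels h hc hsplit hEx hEx',
    O9.exceptionalLeadingTermAt_of_isIsogenous_of_exactnessHyp hWu hJs hJn hHs hHn hGZ hGZK hmod hpar
      hCassels h.symm_of_charZero ((cellC_iff_of_isIsogenous h).mp hc)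
      (IsogenyQuotientLine.hasSplitMultiplicativeReductionAtPrime_of_isIsogenous h hsplit) hEx' hEx⟩

/-- **λ-MINIMAL SPECIAL CASE (T-O9P-1 (a′)), no MC / Schneider binder on either side**: along a
`ℚ`-isogeny between two λ-minimal split X2c curves (`(μ_an, λ_an) = (0, 2)` at both — e.g. a
prime-to-`p` isogeny, `μ_an` being unchanged), the typed residue is invariant outright.
[cite: Wuthrich2014, Thm. 16 (p. 397)] [cite: SteinWuthrich2013, Thm. 6.1 (p. 20) and §4.2] -/
theorem O9.exceptionalLeadingTermAt_iff_of_isIsogenous_of_lamMin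
    (hWu : thm16_charIdeal_dvd_multiplicative_of_reducible)
    (hJs : thm61_splitMultiplicative) (hJn : thm61_nonsplitMultiplicative)
    (hHs : exists_isSplitMultCanonical) (hHn : exists_isMultCanonical)
    (hGZ : GrossZagier1986_thm_I_7_3) (hGZK : rank_eq_analyticRank_of_analyticRank_le_one)
    (hmod : hasEntireLFunction_rat) (hpar : nonempty_modularParametrizationData)
    (hCassels : bsdRHS_eq_of_isIsogenous)
    (h : IsIsogenous W W') (hc : CellC W p) (hsplit : W.HasSplitMultiplicativeReductionAtPrime p)
    (hμ0 : AnalyticMuLE W p 0) (hlam : AnalyticLambdaEq W p 2)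
    (hμ0' : AnalyticMuLE W' p 0) (hlam' : AnalyticLambdaEq W' p 2) :
    O9.ExceptionalLeadingTermAt W p ↔ O9.ExceptionalLeadingTermAt W' p :=
  O9.exceptionalLeadingTermAt_iff_of_isIsogenous_of_exactnessHyp hWu hJs hJn hHs hHn hGZ hGZK hmod hpar
    hCassels h hc hsplit (Or.inr ⟨hμ0, hlam⟩) (Or.inr ⟨hμ0', hlam'⟩)

end Split

/-! ## §3. Rank-one residue EXACTNESS at class level, on the exactness locus -/

section ClassLevel

/-- **T-O9P-1 (b): on the exactness locus the class-wide SPLIT residue and the class-wide `p`-part of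
BSD are EQUIVALENT** (granted the registered facts): over all globally minimal `W` and primes `p` with
`CellC W p`, `p` split and an exactness hypothesis ((MC-at-pair ∧ Schneider-cert) ∨ λ-min),
`(∀ such pairs, O9.ExceptionalLeadingTermAt W p) ↔ (∀ such pairs, BSDp W p)`. The X2c analogue of
`residueB_iff_targetB_of_facts` in its HONEST form: NOT exact off the locus — the Schneider
certificate is not recovered from `BSD(E,p)`, and off the λ-minimal cells Mazur's MC at the pair is
itself a residue (route G needs a relative with known MC; nothing in print at a split Eisenstein
prime). [cite: SteinWuthrich2013, Thm. 6.1 (p. 20) and §4.2] [cite: Wuthrich2014, Thm. 16 (p. 397)]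
[cite: MazurTateTeitelbaum1986Invent, §II.10] [cite: Miller2011LMS, Def. 1.1] -/
theorem O9.forall_exceptionalLeadingTermAt_iff_forall_bsdp_of_exactnessHyp
    (hWu : thm16_charIdeal_dvd_multiplicative_of_reducible)
    (hJs : thm61_splitMultiplicative) (hJn : thm61_nonsplitMultiplicative)
    (hHs : exists_isSplitMultCanonical) (hHn : exists_isMultCanonical)
    (hGZ : GrossZagier1986_thm_I_7_3) (hGZK : rank_eq_analyticRank_of_analyticRank_le_one)
    (hpar : nonempty_modularParametrizationData) :
    (∀ (W : WeierstrassCurve ℚ) [W.IsElliptic] [W.IsGloballyMinimal] (p : ℕ) [Fact p.Prime],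
      CellC W p → W.HasSplitMultiplicativeReductionAtPrime p →
      ((MazurMainConjectureAt W p ∧
          ∀ (Dq : TateParameterData W p) (Dh : PAdicHeightData W p),
            IsSplitMultCanonical Dh Dq → SchneiderConjecture Dh) ∨
        (AnalyticMuLE W p 0 ∧ AnalyticLambdaEq W p 2)) →
      O9.ExceptionalLeadingTermAt W p) ↔
    (∀ (W : WeierstrassCurve ℚ) [W.IsElliptic] [W.IsGloballyMinimal] (p : ℕ) [Fact p.Prime],
      CellC W p → W.HasSplitMultiplicativeReductionAtPrime p →
      ((MazurMainConjectureAt W p ∧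
          ∀ (Dq : TateParameterData W p) (Dh : PAdicHeightData W p),
            IsSplitMultCanonical Dh Dq → SchneiderConjecture Dh) ∨
        (AnalyticMuLE W p 0 ∧ AnalyticLambdaEq W p 2)) →
      BSDp W p) := by
  constructor
  · intro hRes W _ _ p _ hc hsplit hEx
    exact (O9.exceptionalLeadingTermAt_iff_bsdp_of_exactnessHyp_split W p hWu hJs hJn hHs hHn hGZ hGZK
      hpar hc hsplit hEx).mp (hRes W p hc hsplit hEx)
  · intro hB W _ _ p _ hc hsplit hEx
    exact (O9.exceptionalLeadingTermAt_iff_bsdp_of_exactnessHyp_split W p hWu hJs hJn hHs hHn hGZ hGZK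
      hpar hc hsplit hEx).mpr (hB W p hc hsplit hEx)

/-- **The residue is NECESSARY on the locus**: sub-cell X2c's target of record `TargetC`
(`BSD(E,p)` on every X2c pair) IMPLIES the typed exceptional leading term at every split X2c pair
carrying an exactness hypothesis — so in `target_of_facts_of_residues` the split residue `hResCs`
cannot be weakened there. (`TargetC` has no exactness binder, hence no converse at class level beyond
`forall_exceptionalLeadingTermAt_iff_forall_bsdp_of_exactnessHyp`.) [cite: SteinWuthrich2013, Thm. 6.1 (p. 20) and §4.2]
[cite: MazurTateTeitelbaum1986Invent, §II.10] [cite: Miller2011LMS, Def. 1.1] -/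
theorem O9.forall_exceptionalLeadingTermAt_of_targetC
    (hWu : thm16_charIdeal_dvd_multiplicative_of_reducible)
    (hJs : thm61_splitMultiplicative) (hJn : thm61_nonsplitMultiplicative)
    (hHs : exists_isSplitMultCanonical) (hHn : exists_isMultCanonical)
    (hGZ : GrossZagier1986_thm_I_7_3) (hGZK : rank_eq_analyticRank_of_analyticRank_le_one)
    (hpar : nonempty_modularParametrizationData) (hT : TargetC) :
    ∀ (W : WeierstrassCurve ℚ) [W.IsElliptic] [W.IsGloballyMinimal] (p : ℕ) [Fact p.Prime],
      CellC W p → W.HasSplitMultiplicativeReductionAtPrime p →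
      ((MazurMainConjectureAt W p ∧
          ∀ (Dq : TateParameterData W p) (Dh : PAdicHeightData W p),
            IsSplitMultCanonical Dh Dq → SchneiderConjecture Dh) ∨
        (AnalyticMuLE W p 0 ∧ AnalyticLambdaEq W p 2)) →
      O9.ExceptionalLeadingTermAt W p :=
  (O9.forall_exceptionalLeadingTermAt_iff_forall_bsdp_of_exactnessHyp hWu hJs hJn hHs hHn hGZ hGZK
    hpar).mpr fun W _ _ p _ hc _ _ ↦ hT W p hc

/-- **λ-MINIMAL cells, class level, NO binder**: `TargetC` ⟹ the typed residue on every λ-minimal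
split X2c pair, and conversely the residue on those pairs gives `BSD(E,p)` there — on the λ-minimal
split cells (window count 401/592, `O9/SUBPARTITION-typed.md` §5, EVIDENCE) the O9 residue is
literally the `p`-part of BSD, class-wide. [cite: Wuthrich2014, Thm. 16 (p. 397)]
[cite: SteinWuthrich2013, Thm. 6.1 (p. 20) and §4.2] -/
theorem O9.forall_exceptionalLeadingTermAt_iff_forall_bsdp_of_lamMin
    (hWu : thm16_charIdeal_dvd_multiplicative_of_reducible)
    (hJs : thm61_splitMultiplicative) (hJn : thm61_nonsplitMultiplicative)
    (hHs : exists_isSplitMultCanonical) (hHn : exists_isMultCanonical)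
    (hGZ : GrossZagier1986_thm_I_7_3) (hGZK : rank_eq_analyticRank_of_analyticRank_le_one)
    (hpar : nonempty_modularParametrizationData) :
    (∀ (W : WeierstrassCurve ℚ) [W.IsElliptic] [W.IsGloballyMinimal] (p : ℕ) [Fact p.Prime],
      CellC W p → W.HasSplitMultiplicativeReductionAtPrime p →
      AnalyticMuLE W p 0 → AnalyticLambdaEq W p 2 → O9.ExceptionalLeadingTermAt W p) ↔
    (∀ (W : WeierstrassCurve ℚ) [W.IsElliptic] [W.IsGloballyMinimal] (p : ℕ) [Fact p.Prime],
      CellC W p → W.HasSplitMultiplicativeReductionAtPrime p →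
      AnalyticMuLE W p 0 → AnalyticLambdaEq W p 2 → BSDp W p) := by
  constructor
  · intro hRes W _ _ p _ hc hsplit hμ0 hlam
    exact (exceptionalLeadingTermAt_iff_bsdp_of_lamMin_split W p hWu hJs hJn hHs hHn hGZ hGZK hpar hc
      hsplit hμ0 hlam).mp (hRes W p hc hsplit hμ0 hlam)
  · intro hB W _ _ p _ hc hsplit hμ0 hlam
    exact (exceptionalLeadingTermAt_iff_bsdp_of_lamMin_split W p hWu hJs hJn hHs hHn hGZ hGZK hpar hc
      hsplit hμ0 hlam).mpr (hB W p hc hsplit hμ0 hlam)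

end ClassLevel

end Summit.BirchSwinnertonDyer.Rank1Residual.X2

end
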